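/-
Copyright (c) 2026 the pub-hodgecm-mathlib formalisation cell (harness21).  Prover seat hodgecm-mathlib-R90-C14-p02 (g0) (R90-TF free hand routed by CHAIR VALVE W4 to
L1; LEAD F0P6-plan (g14) BATCH #86 (3) 2026-09-04T22:33:10Z «(K1a-4) replacement valve deal»), Track B «K2-LIT», #184♮ = hLiu418 = stmt-HodgeConjecture-24832; line lead
K2E5-p16 (g8), census `K2/K2E5-p16/g8/CENSUS-K1a-GK.K2E5-p16-g8.md` 7c6ffe7718f089b5 §1∕§3 (K1a-4) «two S siblings of ★ O41.5–6»: the GL₁ scalar of the KIND 1 a♮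
(singular, rank-one) big-cell term — `ζ_F^S(2s) ∕ (ζ_F^S(2s+1)·L^S(2s+2, ε))` — as an Euler product of its local factors and its pole-cleared continuation to `Re s > 0`.
-/
import Summits.HodgeConjecture.HodgeConjecture.Theorems.K2LiuSiegelIntertwiningScalarGL1   -- ★ O41.6 (K2Liu-p07): `hasProd_b`, `differentiableOn_b`, `differentiable_update_sub_one_mul_zeta`, `re_two_mul_shifts`
import HarnessLib

/-!
# Crux `HLiu418`, road `K2_Liu`, socket #41 KIND 1 a♮ (K1a-4 siblings): the GL₁ scalar `ζ_F^S(2s) ∕ (ζ_F^S(2s+1)·L^S(2s+2, ε))` of the SINGULAR rank-one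
# big-cell term — Euler product of the local factors `(1 − q_v^{−(2s+1)})(1 − ε_v q_v^{−(2s+2)}) ∕ (1 − q_v^{−2s})`, and `(s − ½)·scalar` holomorphic on `Re s > 0`

Cell `hodgecm-mathlib`, crux item hLiu418 = `stmt-HodgeConjecture-24832`, route `HCCMUnconditional`; squad K2 ∕ K2Liu, LEAD F0P6-plan (g14), line lead K2E5-p16 (g8).
THEOREMS ONLY (no `def`, no instance, no notation, no named-fact hypothesis, no `sorry`, default heartbeats); lane `--supports stmt-HodgeConjecture-24832 --as helper`
(count-neutral).

THE OBJECT (K2E5-p16's census §1, read through the ★ (E4) cocycle `w_Δ = s₂s₁s₂`).  For the rank-one («corner») index `S♭` of socket #41's KIND 1 a♮ term, the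
two UNTWISTED reflections contribute `L_F(2s+1, ε)∕L_F(2s+2, ε)` (long root `2e₁`) and `ζ_{E_w}(2s)∕ζ_{E_w}(2s+1) = ζ_F(2s)L_F(2s,ε)∕(ζ_F(2s+1)L_F(2s+1,ε))` (short root, THE POLE at
`s = ½`), and the TWISTED last letter contributes `L_F(2s, ε)⁻¹ · P°_v(σ; s − ½)`; the factors `L(2s, ε)`, `L(2s+1, ε)` CANCEL and the product of the unramified local scalars is
  **`ζ_F(2s) ∕ (ζ_F(2s+1)·L(2s+2, ε))`** · `∏_{v ∈ D} P°_v` (`D` finite)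
— KIND 0's ★ O41.6 scalar `a^S∕b^S = ζ_F(2s)L(2s−1,ε) ∕ (ζ_F(2s+1)L(2s+2,ε))` WITHOUT its `L^S(2s−1, ε)`.  Same denominator `b^S` (★ `hasProd_b`, ★ `differentiableOn_b`), numerator
`ζ_F^S(2s)` alone, whose only pole on `Re s > 0` is the simple one at `s = ½` (★ `differentiable_update_sub_one_mul_zeta`: `(w − 1)ζ_F^S(w)` entire).
* §1 **`hasProd_localScalarK1`** — for `Re s > ½`: `∏'_{v∉S} (1 − q_v^{−(2s+1)})(1 − ε_v q_v^{−(2s+2)}) ∕ (1 − q_v^{−2s})` `HasProd`-converges to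
  `ζ_F^S(2s) ∕ (ζ_F^S(2s+1)·L^S(2s+2, ε))` (★ `hasProd_partialDedekindZeta` at `2s` times the inverse of ★ `hasProd_b`).
* §2 **`exists_differentiableOn_sub_half_mul_scalarK1`** — `∃ G` HOLOMORPHIC on `{Re s > 0}` with `(s − ½)·ζ_F^S(2s) ∕ (ζ_F^S(2s+1)·L^S(2s+2, ε)) = G(s)` for `Re s > ½`
  (needs only `ε` unitary and `S` finite — no `ε ≠ 1`, no unramified-off-`S`: the numerator has no `L(·, ε)`).
* §3 CM corollaries **`hasProd_localScalarK1_cm`**, **`exists_differentiableOn_sub_half_mul_scalarK1_cm`** (`ε = ε_{L∕L⁺} =` ★ `quadraticHeckeCharCM L`, `F = L⁺`).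
HOW (K1a-4) USES IT: `Theorems/K2LiuRankOneSingularEulerContinued.lean` clears the tail `∏'_{v∉T} W°_v(s)` of ★ G1 `whittakerDelta_eq_mul_tprod_euler` at `S♭` by §1 (★
`K2LiuBigCellTailScalar.tprod_eq_scalar_of_forall_eq` pattern) and continues `(s − ½)·tail` by §2; `ρa = (s − ½)⁻¹`, `G := 1` in ★ p862409's letters of record.
HONEST LABEL.  Count-neutral helper; it retires nothing by itself: `HC_CM` is proved only modulo the 7 printed citations (2 remaining named inputs: hLiu418 =
`stmt-HodgeConjecture-24832`, h413 = `stmt-HodgeConjecture-24833`) until rung 0 closes.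

## References
* [Tan1999] V. Tan, *Poles of Siegel Eisenstein series on U(n,n)*, Canad. J. Math. 51 (1999) 164–175: §3, §4 Prop. 4.8.
* [KudlaRallis1994] S. Kudla, S. Rallis, *A regularized Siegel–Weil formula: the first term identity*, Ann. of Math. 140 (1994): §2 (singular coefficients via `i* ∘ U(s)`).
* [Casselman1980] W. Casselman, *The unramified principal series of 𝔭-adic groups I*, Compositio Math. 40 (1980): §3 Thm. 3.1 (the cocycle).
* [Harris2007] M. Harris, *Cohomological automorphic forms on unitary groups, II* (2007): (1.3.4) p. 92.
* [NeukirchANT1999] J. Neukirch, *Algebraic Number Theory* (1999): Ch. VII Cor. (5.11), §8.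
-/

set_option autoImplicit false
set_option linter.dupNamespace false -- the mandated namespace repeats `HodgeConjecture.HodgeConjecture`

noncomputable section

open scoped NNReal
open Filter Topology Complex NumberField IsDedekindDomain
open Literature.NumberTheory.Automorphic Literature.NumberTheory.LFunctions Literature.NumberTheory.GaloisRepresentations
open Summit.HodgeConjecture.HodgeConjecture.Cruxes.HLiu418.K2LiuSiegelIntertwiningScalarGL1
open Summit.HodgeConjecture.HodgeConjecture.Cruxes.H413.F0P2wPartialDedekindZetaPole

namespace Summit.HodgeConjecture.HodgeConjecture.Cruxes.HLiu418.K2LiuKindOneSingularScalarGL1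

variable {F : Type} [Field F] [NumberField F]

/-! ## §1 The Euler product of the local K1 scalars, `Re s > ½` -/

section GL1

variable {ε : HeckeCharacter F} {S : Set (HeightOneSpectrum (𝓞 F))}

/-- **`ζ_F^S(2s)` as an Euler product, `Re s > ½`**: `∏'_{v∉S} (1 − q_v^{−2s})⁻¹` `HasProd`-converges to it and it is `≠ 0` (★ `hasProd_partialDedekindZeta` at `2s`).
[cite: NeukirchANT1999, Ch. VII §8 (8.1)] -/
theorem hasProd_aK1 {s : ℂ} (hs : 1 / 2 < s.re) :
    HasProd (fun v : {v : HeightOneSpectrum (𝓞 F) // v ∉ S} => (1 - (v.1.residueCard : ℂ) ^ (-(2 * s)))⁻¹)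
      (partialStandardL S (fun _ => {1}) (2 * s)) ∧
    partialStandardL S (fun _ => {1}) (2 * s) ≠ 0 := by
  obtain ⟨h2, -, -, -⟩ := re_two_mul_shifts s
  exact hasProd_partialDedekindZeta (S := S) (s := 2 * s) (by rw [h2]; linarith)

/-- **THE K1 SCALAR AS AN EULER PRODUCT: `∏'_{v∉S} (1 − q_v^{−(2s+1)})(1 − ε_v q_v^{−(2s+2)}) ∕ (1 − q_v^{−2s}) = ζ_F^S(2s) ∕ (ζ_F^S(2s+1)·L^S(2s+2, ε))`**
for `Re s > ½` (so a fortiori on ★ G1's domain `Re s > 1`) — the sibling of ★ O41.6 `hasProd_localScalar` without the factor `L(2s−1, ε)`: `hasProd_aK1` times the inverse of ★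
`hasProd_b` (`Finset.prod_inv_distrib`).  The local factor is the product of the three Gindikin–Karpelevich letters of the KIND 1 a♮ word after the `L(2s,ε)`, `L(2s+1,ε)` cancellation
(census §1). [cite: Tan1999, §4 Prop. 4.8] [cite: Casselman1980, §3 Thm. 3.1] [cite: Harris2007, (1.3.4) p. 92] -/
theorem hasProd_localScalarK1 (hε : ε.IsUnitary) {s : ℂ} (hs : 1 / 2 < s.re) :
    HasProd (fun v : {v : HeightOneSpectrum (𝓞 F) // v ∉ S} =>
        ((1 - (v.1.residueCard : ℂ) ^ (-(2 * s + 1))) * (1 - ε.valueAtUniformizer v.1 * (v.1.residueCard : ℂ) ^ (-(2 * s + 2)))) /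
          (1 - (v.1.residueCard : ℂ) ^ (-(2 * s))))
      (partialStandardL S (fun _ => {1}) (2 * s) /
        (partialStandardL S (fun _ => {1}) (2 * s + 1) * partialStandardL S (fun v => {ε.valueAtUniformizer v}) (2 * s + 2))) := by
  obtain ⟨ha, -⟩ := hasProd_aK1 (S := S) hs
  obtain ⟨hb, hb0⟩ := hasProd_b (S := S) hε (show (0 : ℝ) < s.re by linarith)
  -- invert the `b`-product
  have hbinv : HasProd (fun v : {v : HeightOneSpectrum (𝓞 F) // v ∉ S} =>
      ((1 - (v.1.residueCard : ℂ) ^ (-(2 * s + 1)))⁻¹ *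
        (1 - ε.valueAtUniformizer v.1 * (v.1.residueCard : ℂ) ^ (-(2 * s + 2)))⁻¹)⁻¹)
      (partialStandardL S (fun _ => {1}) (2 * s + 1) * partialStandardL S (fun v => {ε.valueAtUniformizer v}) (2 * s + 2))⁻¹ := by
    unfold HasProd at hb ⊢
    simpa only [Finset.prod_inv_distrib] using hb.inv₀ hb0
  refine (ha.mul hbinv).congr_fun fun v => ?_
  simp only [mul_inv, inv_inv, div_eq_mul_inv]
  ring

/-! ## §2 Continuation: `(s − ½) · scalar` is holomorphic on `Re s > 0` -/

/-- **THE K1 SCALAR, POLE-CLEARED: `∃ G` holomorphic on `{Re s > 0}` with `(s − ½)·ζ_F^S(2s) ∕ (ζ_F^S(2s+1)·L^S(2s+2, ε)) = G(s)` for `Re s > ½`** — the sibling of ★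
O41.5–6 `exists_differentiableOn_sub_half_mul_scalar`: numerator `(s − ½)ζ_F^S(2s) = ½·[(w − 1)ζ_F^S(w)]_{w=2s}` ENTIRE (★ `differentiable_update_sub_one_mul_zeta`), denominator `b^S`
holomorphic and zero-free on `Re s > 0` (★ `differentiableOn_b`, ★ `hasProd_b`).  So the K1 scalar continues to `Re s > 0` with at most a simple pole at `s = ½` and no other singularity;
only `ε` unitary and `S` finite are used (no `L(·, ε)` in the numerator). [cite: Tan1999, §3; §4 Prop. 4.8] [cite: NeukirchANT1999, Ch. VII Cor. (5.11)] -/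
theorem exists_differentiableOn_sub_half_mul_scalarK1 (hε : ε.IsUnitary) (hS : S.Finite) :
    ∃ G : ℂ → ℂ, DifferentiableOn ℂ G {s : ℂ | 0 < s.re} ∧ ∀ s : ℂ, 1 / 2 < s.re →
      (s - 1 / 2) *
        (partialStandardL S (fun _ => {1}) (2 * s) /
          (partialStandardL S (fun _ => {1}) (2 * s + 1) * partialStandardL S (fun v => {ε.valueAtUniformizer v}) (2 * s + 2))) =
        G s := by
  obtain ⟨hZ, hZ_eq⟩ := differentiable_update_sub_one_mul_zeta (F := F) hS
  set Z : ℂ → ℂ := Function.update (fun w : ℂ => (w - 1) *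
        (dedekindZetaCont F w * ∏' v : S, (1 - ((v : HeightOneSpectrum (𝓞 F)).residueCard : ℂ) ^ (-w))))
        1 ((dedekindZeta_residue F : ℂ) * ∏' v : S, (1 - ((v : HeightOneSpectrum (𝓞 F)).residueCard : ℂ) ^ (-(1 : ℂ)))) with hZdef
  have h2 : Differentiable ℂ (fun s : ℂ => 2 * s) := (differentiable_const _).mul differentiable_id
  refine ⟨fun s => 1 / 2 * Z (2 * s) /
      (partialStandardL S (fun _ => {1}) (2 * s + 1) * partialStandardL S (fun v => {ε.valueAtUniformizer v}) (2 * s + 2)),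
    (((differentiable_const _).mul (hZ.comp h2)).differentiableOn).div (differentiableOn_b hε) fun s hs => (hasProd_b hε hs).2,
    fun s hs => ?_⟩
  obtain ⟨h2re, -, -, -⟩ := re_two_mul_shifts s
  have hw : 1 < (2 * s).re := by rw [h2re]; linarith
  have hnum : (s - 1 / 2) * partialStandardL S (fun _ => {1}) (2 * s) = 1 / 2 * Z (2 * s) := by
    rw [hZ_eq (2 * s) hw]
    ring
  show _ = 1 / 2 * Z (2 * s) / _
  rw [← hnum]
  ring

end GL1

/-! ## §3 The CM corollaries: `ε = ε_{L∕L⁺}`, `F = L⁺` -/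

section CM

variable (L : Type) [Field L] [NumberField L] [IsCMField L]

/-- **The K1 scalar at the K2_Liu frame, Euler form**: §1 for `ε = ε_{L∕L⁺}` (★ `quadraticHeckeCharCM L`; finite order ★ `isFiniteOrder_quadraticHeckeCharCM` ⇒ unitary).
[cite: Tan1999, §4 Prop. 4.8] [cite: Harris2007, (1.3.4) p. 92] -/
theorem hasProd_localScalarK1_cm {S : Set (HeightOneSpectrum (𝓞 ↥(maximalRealSubfield L)))} {s : ℂ} (hs : 1 / 2 < s.re) :
    HasProd (fun v : {v : HeightOneSpectrum (𝓞 ↥(maximalRealSubfield L)) // v ∉ S} =>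
        ((1 - (v.1.residueCard : ℂ) ^ (-(2 * s + 1))) *
            (1 - (quadraticHeckeCharCM L).valueAtUniformizer v.1 * (v.1.residueCard : ℂ) ^ (-(2 * s + 2)))) /
          (1 - (v.1.residueCard : ℂ) ^ (-(2 * s))))
      (partialStandardL S (fun _ => {1}) (2 * s) /
        (partialStandardL S (fun _ => {1}) (2 * s + 1) *
          partialStandardL S (fun v => {(quadraticHeckeCharCM L).valueAtUniformizer v}) (2 * s + 2))) :=
  hasProd_localScalarK1 (Literature.RepresentationTheory.HarrisKudlaSweet1996.isFiniteOrder_quadraticHeckeCharCM (L := L)).isUnitary hs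

/-- **The K1 scalar at the K2_Liu frame, pole-cleared continuation**: §2 for `ε = ε_{L∕L⁺}` — `∃ G` holomorphic on `{Re s > 0}` with
`(s − ½)·ζ_{L⁺}^S(2s) ∕ (ζ_{L⁺}^S(2s+1)·L^S(2s+2, ε_{L∕L⁺})) = G(s)` for `Re s > ½` (any finite `S`). [cite: Tan1999, §3; §4 Prop. 4.8] [cite: NeukirchANT1999, Ch. VII Cor. (5.11)] -/
theorem exists_differentiableOn_sub_half_mul_scalarK1_cm {S : Set (HeightOneSpectrum (𝓞 ↥(maximalRealSubfield L)))} (hS : S.Finite) :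
    ∃ G : ℂ → ℂ, DifferentiableOn ℂ G {s : ℂ | 0 < s.re} ∧ ∀ s : ℂ, 1 / 2 < s.re →
      (s - 1 / 2) *
        (partialStandardL S (fun _ => {1}) (2 * s) /
          (partialStandardL S (fun _ => {1}) (2 * s + 1) *
            partialStandardL S (fun v => {(quadraticHeckeCharCM L).valueAtUniformizer v}) (2 * s + 2))) =
        G s :=
  exists_differentiableOn_sub_half_mul_scalarK1
    (Literature.RepresentationTheory.HarrisKudlaSweet1996.isFiniteOrder_quadraticHeckeCharCM (L := L)).isUnitary hS

end CM

end Summit.HodgeConjecture.HodgeConjecture.Cruxes.HLiu418.K2LiuKindOneSingularScalarGL1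

end
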